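import Summits.HodgeConjecture.HodgeConjecture.Theorems.F0P6aEReadings   -- ★ p853026 VERBATIM TWIN (LAST part; parts `…F0P6aEReadingsDefs` p852973 → `…F0P6aEReadingsHecke` p852992 ride the import) of tree `Lines/F0_P6a_EReadings.lean` 18b1390e9a57b55f (961 l.; namespace KEPT)
import HarnessLib
import HarnessLib.Audit.LibrarySuggestionsDenyListCruxes

/-! # F0_P6a_EReadings — ED. 3 = SHIM (K6 P∕E column, LEAD F0P6-plan «M-142a» (B) ∕ «M-145d»; pen «L7» LA7-plan (g7), RE-HOME TABLE v1.7; box LAref-P (g5) first ∕ LA-ref1 (g5) second)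

Every declaration of the previous edition (tree sha16 18b1390e9a57b55f, 961 l., sorry-free; 27 declarations, e.g. `EHeckeAt`, `ETwistKerAt`, `lineRoofΩ_of_E`, `centralRoofΩ_of_E`, `heckeRoofsAt_of_E`, `stub_HECKETRANS`, `coverΩ_of_gen_iso`, `stub_COVERKERTRANS`, `coverKerΩ_of_gen_iso`)
now lives, byte for byte (module docstring → `/- … -/` archaeology comment; closed `[cite:]` letters carry `(print: …)` locators — gate relocation rule) and under the SAME namespace
`Summit.HodgeConjecture.HodgeConjecture.Cruxes.HLiu418.F0P6aEReadings`, in ★ `Theorems/F0P6aEReadingsDefs.lean` (p852973) → ★ `Theorems/F0P6aEReadingsHecke.lean` (p852992) → ★ `Theorems/F0P6aEReadings.lean` (p853026); this module keeps its name so that its tree importers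
(`F0_P6a_CoverEOfComplex.lean`, `F0_P6a_StubEHECKE.lean`, `F0_P6a_StubESHEET.lean`, `F0_P6a_EExports.lean`, `F0_P6a_StubGEN.lean` and any by-name reader under `open …F0P6aEReadings`) resolve unchanged through the import above.
It declares nothing.  No declaration was cut in the ★ twin (verbatim re-home) ⇒ nothing to alias.
ORDER NOTE: written on the LEAD՚s K6 shim-wave word together with the other shims of that wave; its `Lines` rev-closure by name (`F0_P6a_CoverEOfComplex`, `F0_P6a_StubEHECKE`, `F0_P6a_StubESHEET`, `F0_P6a_EExports`, `F0_P6a_StubGEN`, `F0_P6a_ModuliDatum`, `F0_D9opRoad2`, `F0_AlbCm`) re-makes in the same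
request (NO-CROSS-IMPORT: no environment may hold a `Lines/` ORIGINAL of this module together with its ★ twin); an importer smoke that reads «environment already contains …»
before that request is BUILT is this order note, not a defect.  Edition history stays in the line card and in git; future changes are ★-side proposals on the `Theorems/` files.
HC_CM is proved only modulo the 7 printed citations (2 remaining named inputs: hLiu418 = stmt-HodgeConjecture-24832, h413 = stmt-HodgeConjecture-24833) until rung 0 closes; count-neutral (0 `sorry`, 0 socket, 0 declarations). -/
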